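import Mathlib
import Literature.NumberTheory.EllipticCurves.Smith2016.CongruentNumberGenusDeterminantRowThreeHolds
import Literature.NumberTheory.EllipticCurves.Smith2016.CongruentNumberGenusDeterminantRowTwoHolds
import Literature.NumberTheory.EllipticCurves.Smith2016.CongruentNumberGenusDeterminantRowsTwoThreeConsequences
import Literature.NumberTheory.EllipticCurves.Smith2016.CongruentNumberGenusDeterminantUnconditional

/-!
# Tian–Yuan–Zhang's Theorem 1.2 on `n ≡ 2, 3 (mod 8)` — now UNCONDITIONAL; and on all of `n ≡ 1, 2, 3 (mod 8)`

With `smith_thm22_rowThree_holds` (`CongruentNumberGenusDeterminantRowThreeHolds`) and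
`smith_thm22_rowTwo_holds` (`CongruentNumberGenusDeterminantRowTwoHolds`) — Smith 2016, Thm. 2.2 rows 3
and 2, `ℒ₃(n) = det M`, `ℒ₂(n) = det M` (Monsky's matrices), proved for every number of prime factors —
the theorems of `CongruentNumberGenusDeterminantRowsTwoThreeConsequences` stated RELATIVE to the named
facts become tree theorems [Smith2016CongruentDensity, Thm. 1.2, Thm. 2.2, §4 Thm. 4.1 / Cor. 4.2;
TianYuanZhang2017, Thm. 1.2 (journal numbering)]: for every square-free `N ≡ 2` or `3 (mod 8)`,
`rank E_N(ℚ) = 0 ∧ Ш(E_N/ℚ)[2^∞] = 0 ⟺ #Sel⁽²⁾(E_N/ℚ) = 4 ⟺ Σ_{N = d₀⋯d_ℓ, dᵢ ≡ 1 (8) (i>0)} ∏ g(dᵢ)` odd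
(no `L`-function anywhere: Monsky's exact formula, the descent count both ways, Rédei–Reichardt, the
bipartite forest formula and the adjugate calculus are all tree theorems).  Together with the row-1 file
`CongruentNumberGenusDeterminantUnconditional`: **Tian–Yuan–Zhang's (journal) Theorem 1.2 holds in the
kernel for every square-free `N ≡ 1, 2, 3 (mod 8)`** (`rank_zero_and_sha_iff_odd_genusSum₁_of_mod_eight`).
-/

namespace Literature.NumberTheory.EllipticCurves.Smith2016

open _root_.Matrix Literature.NumberTheory.EllipticCurves.HeathBrown1994
open Literature.NumberTheory.EllipticCurves.TianYuanZhang2017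

variable {k : ℕ} (p : Fin k → ℕ)

/-- **TYZ (journal) Theorem 1.2 on `n ≡ 3 (mod 8)`, every `k`, UNCONDITIONALLY**: for `n = p₁⋯p_k ≡ 3 (mod 8)`
a product of distinct odd primes, `rank E⁽ⁿ⁾(ℚ) = 0 ∧ Ш(E⁽ⁿ⁾/ℚ)[2^∞] = 0 ⟺ Σ∏g(dᵢ)` odd.
[cite: TianYuanZhang2017, Thm. 1.2 (journal numbering)] [cite: Smith2016CongruentDensity, Thm. 1.2, Thm. 2.2 row 3] -/
theorem rank_zero_and_sha_iff_odd_genusSum₁_three (hp : ∀ i, (p i).Prime) (hodd : ∀ i, Odd (p i))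
    (hinj : Function.Injective p) (h8 : (∏ i, p i) % 8 = 3) :
    ((haveI := isElliptic_congruentNumberCurve (Squarefree.ne_zero (squarefree_prod_of_injective p hp hinj));
        (congruentNumberCurve (∏ i, p i)).mordellWeilRank = 0) ∧
      (haveI := isElliptic_congruentNumberCurve (Squarefree.ne_zero (squarefree_prod_of_injective p hp hinj));
        AddCommGroup.primaryComponent (congruentNumberCurve (∏ i, p i)).sha 2 = ⊥)) ↔
      Odd (genusSum₁ (∏ i, p i) fun d => genusClassNumber (GenusField d)) :=
  rank_zero_and_sha_iff_odd_genusSum₁_of_smith_rowThree p smith_thm22_rowThree_holds hp hodd hinj h8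

/-- **TYZ (journal) Theorem 1.2 on `n ≡ 2 (mod 8)`, every `k`, UNCONDITIONALLY**: for `n = 2p₁⋯p_k` with
`∏ pᵢ ≡ 1 (mod 4)`, `rank E⁽ⁿ⁾(ℚ) = 0 ∧ Ш(E⁽ⁿ⁾/ℚ)[2^∞] = 0 ⟺ Σ∏g(dᵢ)` odd.
[cite: TianYuanZhang2017, Thm. 1.2 (journal numbering)] [cite: Smith2016CongruentDensity, Thm. 1.2, Thm. 2.2 row 2] -/
theorem rank_zero_and_sha_iff_odd_genusSum₁_two (hp : ∀ i, (p i).Prime) (hodd : ∀ i, Odd (p i))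
    (hinj : Function.Injective p) (h4 : (∏ i, p i) % 4 = 1) :
    ((haveI := isElliptic_congruentNumberCurve
        (Squarefree.ne_zero (squarefree_two_mul_prod_of_injective p hp hodd hinj));
        (congruentNumberCurve (2 * ∏ i, p i)).mordellWeilRank = 0) ∧
      (haveI := isElliptic_congruentNumberCurve
        (Squarefree.ne_zero (squarefree_two_mul_prod_of_injective p hp hodd hinj));
        AddCommGroup.primaryComponent (congruentNumberCurve (2 * ∏ i, p i)).sha 2 = ⊥)) ↔
      Odd (genusSum₁ (2 * ∏ i, p i) fun d => genusClassNumber (GenusField d)) :=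
  rank_zero_and_sha_iff_odd_genusSum₁_of_smith_rowTwo p smith_thm22_rowTwo_holds hp hodd hinj h4

/-- **`#Sel⁽²⁾(E⁽ⁿ⁾/ℚ) = 4 ⟺ Σ∏g(dᵢ)` odd**, `n = p₁⋯p_k ≡ 3 (mod 8)`, unconditionally.
[cite: Smith2016CongruentDensity, Thm. 1.2 and Thm. 2.2 row 3 (chunk p0005 L59–L75)] -/
theorem card_selmerGroup_two_eq_four_iff_odd_genusSum₁_three (hp : ∀ i, (p i).Prime)
    (hodd : ∀ i, Odd (p i)) (hinj : Function.Injective p) (h8 : (∏ i, p i) % 8 = 3) :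
    Nat.card ((congruentNumberCurve (∏ i, p i)).selmerGroup 2) = 4 ↔
      Odd (genusSum₁ (∏ i, p i) fun d => genusClassNumber (GenusField d)) :=
  card_selmerGroup_two_eq_four_iff_odd_genusSum₁_of_smith_rowThree p smith_thm22_rowThree_holds hp hodd
    hinj h8

/-- **`#Sel⁽²⁾(E⁽ⁿ⁾/ℚ) = 4 ⟺ Σ∏g(dᵢ)` odd**, `n = 2p₁⋯p_k`, `∏ pᵢ ≡ 1 (mod 4)`, unconditionally.
[cite: Smith2016CongruentDensity, Thm. 1.2 and Thm. 2.2 row 2 (chunk p0005 L59–L75)] -/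
theorem card_selmerGroup_two_eq_four_iff_odd_genusSum₁_two (hp : ∀ i, (p i).Prime)
    (hodd : ∀ i, Odd (p i)) (hinj : Function.Injective p) (h4 : (∏ i, p i) % 4 = 1) :
    Nat.card ((congruentNumberCurve (2 * ∏ i, p i)).selmerGroup 2) = 4 ↔
      Odd (genusSum₁ (2 * ∏ i, p i) fun d => genusClassNumber (GenusField d)) :=
  card_selmerGroup_two_eq_four_iff_odd_genusSum₁_of_smith_rowTwo p smith_thm22_rowTwo_holds hp hodd
    hinj h4

/-- **TYZ Theorem 1.2 for EVERY square-free `N ≡ 3 (mod 8)`, unconditionally**: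
`rank E_N(ℚ) = 0 ∧ Ш(E_N/ℚ)[2^∞] = 0 ⟺ Σ∏g(dᵢ)` odd. [cite: TianYuanZhang2017, Thm. 1.2 (journal numbering)] [cite: Smith2016CongruentDensity, Thm. 1.2, Thm. 2.2 row 3] -/
theorem rank_zero_and_sha_iff_odd_genusSum₁_three' {N : ℕ} (hN : Squarefree N) (h8 : N % 8 = 3) :
    ((haveI := isElliptic_congruentNumberCurve (Squarefree.ne_zero hN);
        (congruentNumberCurve N).mordellWeilRank = 0) ∧
      (haveI := isElliptic_congruentNumberCurve (Squarefree.ne_zero hN);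
        AddCommGroup.primaryComponent (congruentNumberCurve N).sha 2 = ⊥)) ↔
      Odd (genusSum₁ N fun d => genusClassNumber (GenusField d)) :=
  rank_zero_and_sha_iff_odd_genusSum₁_of_smith_rowThree' smith_thm22_rowThree_holds hN h8

/-- **TYZ Theorem 1.2 for EVERY square-free `N ≡ 2 (mod 8)`, unconditionally**:
`rank E_N(ℚ) = 0 ∧ Ш(E_N/ℚ)[2^∞] = 0 ⟺ Σ∏g(dᵢ)` odd. [cite: TianYuanZhang2017, Thm. 1.2 (journal numbering)] [cite: Smith2016CongruentDensity, Thm. 1.2, Thm. 2.2 row 2] -/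
theorem rank_zero_and_sha_iff_odd_genusSum₁_two' {N : ℕ} (hN : Squarefree N) (h8 : N % 8 = 2) :
    ((haveI := isElliptic_congruentNumberCurve (Squarefree.ne_zero hN);
        (congruentNumberCurve N).mordellWeilRank = 0) ∧
      (haveI := isElliptic_congruentNumberCurve (Squarefree.ne_zero hN);
        AddCommGroup.primaryComponent (congruentNumberCurve N).sha 2 = ⊥)) ↔
      Odd (genusSum₁ N fun d => genusClassNumber (GenusField d)) :=
  rank_zero_and_sha_iff_odd_genusSum₁_of_smith_rowTwo' smith_thm22_rowTwo_holds hN h8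

/-- **Tian–Yuan–Zhang (journal) Theorem 1.2 = Smith Thm. 4.1 / Cor. 4.2 on ALL of `n ≡ 1, 2, 3 (mod 8)`,
UNCONDITIONALLY**: for every square-free `N` with `N mod 8 ∈ {1, 2, 3}`,
`rank E_N(ℚ) = 0 ∧ Ш(E_N/ℚ)[2^∞] = 0 ⟺ Σ_{N = d₀⋯d_ℓ, dᵢ ≡ 1 (8) (i>0)} ∏ᵢ g(dᵢ)` is odd
(`g(d) = #2Cl(ℚ(√−d))`). [cite: TianYuanZhang2017, Thm. 1.2 (journal numbering)] [cite: Smith2016CongruentDensity, Thm. 1.2 with Thm. 2.2 (rows 1, 2, 3)] -/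
theorem rank_zero_and_sha_iff_odd_genusSum₁_of_mod_eight {N : ℕ} (hN : Squarefree N)
    (h8 : N % 8 = 1 ∨ N % 8 = 2 ∨ N % 8 = 3) :
    ((haveI := isElliptic_congruentNumberCurve (Squarefree.ne_zero hN);
        (congruentNumberCurve N).mordellWeilRank = 0) ∧
      (haveI := isElliptic_congruentNumberCurve (Squarefree.ne_zero hN);
        AddCommGroup.primaryComponent (congruentNumberCurve N).sha 2 = ⊥)) ↔
      Odd (genusSum₁ N fun d => genusClassNumber (GenusField d)) := by
  rcases h8 with h | h | h
  · exact rank_zero_and_sha_iff_odd_genusSum₁' hN h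
  · exact rank_zero_and_sha_iff_odd_genusSum₁_two' hN h
  · exact rank_zero_and_sha_iff_odd_genusSum₁_three' hN h

/-- **Smith 2016, Theorem 1.2 (Conjecture 1.1 for the quadratic twists `E⁽ᴺ⁾`, `N ≡ 1, 2, 3 (mod 8)`), relative
to Tian–Yuan–Zhang's Theorem 1.1 ALONE**: for every square-free `N` with `N mod 8 ∈ {1, 2, 3}`, TYZ's integer
`𝓛(N)` is odd iff `#Sel⁽²⁾(E⁽ᴺ⁾/ℚ) = 4` (the `2`-Selmer group is generated by the `2`-torsion).  The only
named fact used is `thm11_parity_of_scriptL` (`𝓛(N) ≡ Σ∏g(dᵢ) (mod 2)`); Thm. 2.2 rows 1–3 and the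
`2`-descent are tree theorems. [cite: Smith2016CongruentDensity, Thm. 1.2 (chunk p0003 L29–L31) with §2 proof (chunk p0005 L65–L75)] [cite: TianYuanZhang2017, Thm. 1.1] -/
theorem exists_scriptL_odd_iff_card_selmerGroup_two_eq_four_of_mod_eight
    (h11 : thm11_parity_of_scriptL) {N : ℕ} (hN : Squarefree N)
    (h8 : N % 8 = 1 ∨ N % 8 = 2 ∨ N % 8 = 3) :
    ∃ L : ℤ, IsScriptL N L ∧ (Odd L ↔ Nat.card ((congruentNumberCurve N).selmerGroup 2) = 4) := by
  obtain ⟨L, hL, hpar⟩ := h11 N hN h8 GenusField (isGenusFieldFamily_genusField _)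
  refine ⟨L, hL, ?_⟩
  rw [← ZMod.intCast_eq_one_iff_odd, hpar, ZMod.natCast_eq_one_iff_odd,
    ← rank_zero_and_sha_iff_odd_genusSum₁_of_mod_eight hN h8,
    card_selmerGroup_two_eq_four_iff_rank_zero_and_sha (Squarefree.ne_zero hN)]

/-- The same in the rank/`Ш` form: for square-free `N ≡ 1, 2, 3 (mod 8)`, `𝓛(N)` is odd iff
`rank E_N(ℚ) = 0` and `Ш(E_N/ℚ)[2^∞] = 0`, relative to TYZ Thm. 1.1 alone.
[cite: Smith2016CongruentDensity, Thm. 1.2 and Cor. 1.3 (chunk p0003 L29–L44)] [cite: TianYuanZhang2017, Thm. 1.1 and Thm. 1.2 (journal numbering)] -/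
theorem exists_scriptL_odd_iff_rank_zero_and_sha_of_mod_eight
    (h11 : thm11_parity_of_scriptL) {N : ℕ} (hN : Squarefree N)
    (h8 : N % 8 = 1 ∨ N % 8 = 2 ∨ N % 8 = 3) :
    ∃ L : ℤ, IsScriptL N L ∧ (Odd L ↔
      ((haveI := isElliptic_congruentNumberCurve (Squarefree.ne_zero hN);
          (congruentNumberCurve N).mordellWeilRank = 0) ∧
        (haveI := isElliptic_congruentNumberCurve (Squarefree.ne_zero hN);
          AddCommGroup.primaryComponent (congruentNumberCurve N).sha 2 = ⊥))) := by
  obtain ⟨L, hL, hpar⟩ := h11 N hN h8 GenusField (isGenusFieldFamily_genusField _)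
  refine ⟨L, hL, ?_⟩
  rw [← ZMod.intCast_eq_one_iff_odd, hpar, ZMod.natCast_eq_one_iff_odd,
    rank_zero_and_sha_iff_odd_genusSum₁_of_mod_eight hN h8]

end Literature.NumberTheory.EllipticCurves.Smith2016
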